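import Summits.AtomisticToContinuum.FouriersLaw.Theses.BondHeatUncertainty
import Summits.AtomisticToContinuum.FouriersLaw.Theorems.ExtensiveSnapshotIrreversibility.Negative.LoadBearingHypotheses
import Summits.AtomisticToContinuum.FouriersLaw.Theorems.ExtensiveSnapshotIrreversibility.Negative.DegenerateInstances
import Summits.AtomisticToContinuum.FouriersLaw.Theorems.BondHeatUncertaintyExtensiveSnapshotIrreversibilityKernelFacts
import Summits.AtomisticToContinuum.FouriersLaw.Theorems.BondHeatUncertaintyExtensiveSnapshotIrreversibilityCorrectorIntegrability
import Summits.AtomisticToContinuum.FouriersLaw.Theorems.BondHeatUncertaintyExtensiveSnapshotIrreversibilityCorrectorCocycle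
import Summits.AtomisticToContinuum.FouriersLaw.Theorems.BondHeatUncertaintyExtensiveSnapshotIrreversibilityGibbsContactCalculus
import Summits.AtomisticToContinuum.FouriersLaw.Theorems.BondHeatUncertaintyExtensiveSnapshotIrreversibilityClausiusBudget
import Summits.AtomisticToContinuum.FouriersLaw.Theorems.BondHeatUncertaintyExtensiveSnapshotIrreversibilityMcLennanIdentification
import Summits.AtomisticToContinuum.FouriersLaw.Theorems.BondHeatUncertaintyExtensiveSnapshotIrreversibilitySnapshotKLUpperReduction
import Summits.AtomisticToContinuum.FouriersLaw.Theorems.BondHeatUncertaintyExtensiveSnapshotIrreversibilityResponseDensity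
import Summits.AtomisticToContinuum.FouriersLaw.Theorems.BondHeatUncertaintyExtensiveSnapshotIrreversibilityLateOddResponseOfFisher
import Summits.AtomisticToContinuum.FouriersLaw.Theorems.BondHeatUncertaintyExtensiveSnapshotIrreversibilityCorrectorHeatSplit
import Summits.AtomisticToContinuum.FouriersLaw.Theorems.BondHeatUncertaintyExtensiveSnapshotIrreversibilityOddLogDensityOfRegularity
import Summits.AtomisticToContinuum.FouriersLaw.Theorems.BondHeatUncertaintyExtensiveSnapshotIrreversibilityOddLogDensityOfOddRegularity
import Summits.AtomisticToContinuum.FouriersLaw.Theorems.BondHeatUncertaintyExtensiveSnapshotIrreversibilityOddCorrectorOfKuboCorrector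

/-!
# `ExtensiveSnapshotIrreversibility` (K) from its two sub-cruxes — the SPLIT theorem (strategist, decomposition (b))

Item stmt-AtomisticToContinuum-9121, route `BondHeatUncertainty`.  This file is the lead's kernel-checked skeleton v10
(`Cruxes/ExtensiveSnapshotIrreversibility/Lines/clausius_budget_sound_window.lean`, prover-line-stmt-AtomisticToContinuum-9121-c0…c4)
with its two remaining `sorry`-stubs turned into HYPOTHESES, so that the crux can be split at route level into exactly those two
statements (`ledger route edit --split ExtensiveSnapshotIrreversibility --into … --glue-by` this theorem):

* `OddLogDensityRegularity` (= S1r' `stub_oddLogDensityRegularity`, FIXED `N ≥ 2`): the NESS `μ_{N,T+δ/2,T−δ/2}` is the Gibbs state at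
  `T` reweighted by `e^{φ_δ}` with an upper Gibbs-type bound, pointwise continuity in `δ`, and two-sided `O(δ)` control plus a pointwise
  `δ`-derivative of the ODD part `φ_δ − φ_δ∘Θ` — the unprinted fixed-`N` analytic debt (δ-uniform local quantitative hypoelliptic regularity
  + pointwise δ-C¹ of the log-density);
* `KuboCorrectorOddCubicBound` (= S4k `stub_kuboCorrectorOddCubicBound`, `N`-UNIFORM): `∫ (u − u∘Θ)² dμ_T ≤ C·N³` for every `L²(μ_T)`
  a.e.-limit `u` of the finite-horizon Kubo integrals of the total current — by the landed fixed-`N` dictionary EXACTLY `2K_N ≤ C'·N`,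
  the crux's whole `N`-uniform content; implied (landed bridge `kuboCorrectorOddCubic_of_coneScale`) by the sibling crux
  `OddSectorIrreversibility.ConeScaleCorrector` (E1, stmt-14069) with a factor `N` and the even sector to spare, and order-tight at the
  harmonic corner where E1 fails.

`ExtensiveSnapshotIrreversibility_of_subs : OddLogDensityRegularity-statement → KuboCorrectorOddCubicBound-statement →
ExtensiveSnapshotIrreversibility` is sorry-free; every other ingredient is a LANDED theorem cited by name (S0 p77081, S1a p91177,
S1b p95551, S1c-reduction p91778, S1g' p120594, S2a p81088, S2b p82521, S3a p82446, S3b p89857, S4k→S4o p124332, Negative/DegenerateInstances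
p72631 for `N = 0, 1`).  The arithmetic core `concl_of_parts` and `sq_bound_of_sqrt_le` are v10's, verbatim.
-/

noncomputable section

namespace Summit.AtomisticToContinuum.FouriersLaw.Theorems.ExtensiveSnapshotIrreversibility.Split

open MeasureTheory Filter Topology InformationTheory
open scoped ENNReal NNReal
open Literature.MathematicalPhysics.KineticTheory.HeatConduction
open Summit.AtomisticToContinuum.FouriersLaw.Theses.BondHeatUncertainty
open Summit.AtomisticToContinuum.FouriersLaw.Theorems.ExtensiveSnapshotIrreversibility.Negative
open Summit.AtomisticToContinuum.FouriersLaw.Theorems.ExtensiveSnapshotIrreversibility.ClausiusBudget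

/-- Real arithmetic of the window split: `√D ≤ 2√A' + √B'`, `A' ≤ A`, `B' ≤ B` (all nonnegative) give
`D ≤ 8A + 2B`. -/
theorem sq_bound_of_sqrt_le {D A' B' A B : ℝ} (hD : 0 ≤ D) (hA' : 0 ≤ A') (hB' : 0 ≤ B')
    (hA : A' ≤ A) (hB : B' ≤ B) (h : Real.sqrt D ≤ 2 * Real.sqrt A' + Real.sqrt B') :
    D ≤ 8 * A + 2 * B := by
  have hsA : Real.sqrt A' ≤ Real.sqrt A := Real.sqrt_le_sqrt hA
  have hsB : Real.sqrt B' ≤ Real.sqrt B := Real.sqrt_le_sqrt hB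
  have hA0 : 0 ≤ A := hA'.trans hA
  have hB0 : 0 ≤ B := hB'.trans hB
  have h' : Real.sqrt D ≤ 2 * Real.sqrt A + Real.sqrt B := h.trans (by linarith)
  have h1 : Real.sqrt D * Real.sqrt D ≤ (2 * Real.sqrt A + Real.sqrt B) * (2 * Real.sqrt A + Real.sqrt B) :=
    mul_self_le_mul_self (Real.sqrt_nonneg _) h'
  have hDD : Real.sqrt D * Real.sqrt D = D := Real.mul_self_sqrt hD
  have hAA : Real.sqrt A * Real.sqrt A = A := Real.mul_self_sqrt hA0
  have hBB : Real.sqrt B * Real.sqrt B = B := Real.mul_self_sqrt hB0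
  nlinarith [sq_nonneg (2 * Real.sqrt A - Real.sqrt B), Real.sqrt_nonneg A, Real.sqrt_nonneg B]

/-- **Abstract arithmetic core of the composition.** For one parameter point, one family and one `T > 0`: with
`Dw N` the reversal asymmetry of the corrector, `Wk N τ` the squared window norm and `Dl N τ` the late reversal
asymmetry (any real-valued bookkeeping functions, nonnegative), the four stub-shaped hypotheses give the crux's conclusion
with `C_K = γc/T² + max C 0 + 1`; `N = 0, 1` by the landed Negative lemmas. -/
theorem concl_of_parts {ω₂ lam β γ : ℝ} (hω : 0 < ω₂) (hl : 0 < lam) (hβ : 0 < β) (hγ : 0 < γ)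
    (hU : ∀ (N : ℕ) (T_L T_R : ℝ), 0 < T_L → 0 < T_R → ∀ μ ν : Measure (PhaseSpace N),
      (pinnedChain ω₂ lam β γ).IsSteadyState N T_L T_R μ →
      (pinnedChain ω₂ lam β γ).IsSteadyState N T_L T_R ν → μ = ν)
    {μ : (N : ℕ) → ℝ → ℝ → Measure (PhaseSpace N)}
    (hμ : ∀ (N : ℕ) (T_L T_R : ℝ), 0 < T_L → 0 < T_R →
      (pinnedChain ω₂ lam β γ).IsSteadyState N T_L T_R (μ N T_L T_R))
    {T : ℝ} (hT : 0 < T) {C c : ℝ} (hc : 0 < c)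
    (Dw : ℕ → ℝ) (Wk Dl : ℕ → ℝ → ℝ) (hDw : ∀ N, 0 ≤ Dw N) (hWk : ∀ N τ, 0 ≤ Wk N τ) (hDl : ∀ N τ, 0 ≤ Dl N τ)
    (hKL : ∀ N : ℕ, 2 ≤ N → ∀ ε : ℝ, 0 < ε → ∀ᶠ δ in 𝓝[≠] (0 : ℝ),
      klDiv (μ N (T + δ / 2) (T - δ / 2))
          (Measure.map (fun x : PhaseSpace N => (x.1, -x.2)) (μ N (T + δ / 2) (T - δ / 2)))
        ≤ ENNReal.ofReal ((Dw N / 2 + ε) * δ ^ 2))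
    (hSplit : ∀ N : ℕ, 2 ≤ N → ∀ τ : ℝ, 0 ≤ τ →
      Real.sqrt (Dw N) ≤ 2 * Real.sqrt (Wk N τ) + Real.sqrt (Dl N τ))
    (hBudget : ∀ N : ℕ, 2 ≤ N → ∀ τ : ℝ, 0 ≤ τ → Wk N τ ≤ γ * τ / (4 * T ^ 2))
    (hLate : ∀ N : ℕ, 2 ≤ N → ∃ τ : ℝ, 0 ≤ τ ∧ τ ≤ c * N ∧ Dl N τ ≤ C * N) :
    ∃ C' : ℝ, ∀ N : ℕ, ∀ᶠ δ in 𝓝[≠] (0 : ℝ),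
      klDiv (μ N (T + δ / 2) (T - δ / 2))
          (Measure.map (fun x : PhaseSpace N => (x.1, -x.2)) (μ N (T + δ / 2) (T - δ / 2)))
        ≤ ENNReal.ofReal (C' * (N : ℝ) * δ ^ 2) := by
  refine ⟨γ * c / T ^ 2 + max C 0 + 1, fun N => ?_⟩
  rcases Nat.lt_or_ge N 2 with hN | hN
  · interval_cases N
    · exact extensiveSnapshotIrreversibility_bound_at_zero hμ hT _
    · exact extensiveSnapshotIrreversibility_bound_at_one hω hl hβ hU hμ hT _
  · have hN0 : (0 : ℝ) ≤ N := by positivity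
    have hN1 : (1 : ℝ) ≤ N := by exact_mod_cast (le_trans (by norm_num) hN)
    obtain ⟨τ, hτ0, hτc, hL⟩ := hLate N hN
    have hT2 : 0 < T ^ 2 := by positivity
    have hBτ : Wk N τ ≤ γ * (c * N) / (4 * T ^ 2) :=
      (hBudget N hN τ hτ0).trans
        (div_le_div_of_nonneg_right (mul_le_mul_of_nonneg_left hτc hγ.le) (by positivity))
    have hkey : Dw N ≤ 8 * (γ * (c * N) / (4 * T ^ 2)) + 2 * (max C 0 * N) :=
      sq_bound_of_sqrt_le (hDw N) (hWk N τ) (hDl N τ) hBτ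
        (hL.trans (mul_le_mul_of_nonneg_right (le_max_left _ _) hN0))
        (hSplit N hN τ hτ0)
    filter_upwards [hKL N hN 1 one_pos] with δ hδ
    refine hδ.trans (ENNReal.ofReal_le_ofReal ?_)
    have hδ2 : 0 ≤ δ ^ 2 := sq_nonneg δ
    apply mul_le_mul_of_nonneg_right _ hδ2
    have h8 : 8 * (γ * (c * N) / (4 * T ^ 2)) = 2 * (γ * c / T ^ 2 * N) := by
      field_simp
      ring
    rw [h8] at hkey
    have hgc : 0 ≤ γ * c / T ^ 2 := by positivity
    have hm : 0 ≤ max C 0 := le_max_right _ _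
    nlinarith [hkey, hgc, hm, hN1, mul_nonneg hgc hN0, mul_nonneg hm hN0]

/-- **S4 from S4k** (v10: S4 ⟸ S4o at `τ = 0`; S4o ⟸ S4k by the landed `oddCorrectorBound_of_kuboCorrectorOddCubic`). -/
theorem lateOddResponse_of_kuboCorrectorOddCubic
    (hK : ∀ ω₂ lam β γ : ℝ, 0 < ω₂ → 0 < lam → 0 < β → 0 < γ → ∀ T : ℝ, 0 < T → ∃ C : ℝ,
            ∀ (N : ℕ) (u : PhaseSpace N → ℝ), 2 ≤ N →
              let P := pinnedChain ω₂ lam β γ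
              let μT := P.gibbsMeasure N T
              let J : PhaseSpace N → ℝ := fun z => ∑ i : Fin N, P.bondCurrent N i z
              MemLp u 2 μT →
              (∀ᵐ x ∂μT, Tendsto (fun τ : ℝ => ∫ t in Set.Ioc (0 : ℝ) τ,
                  (∫ y, J y ∂(P.transitionKernel N T T t.toNNReal x))) atTop (𝓝 (u x))) →
              ∫ x, (u x - u (x.1, -x.2)) ^ 2 ∂μT ≤ C * (N : ℝ) ^ 3) :
    ∀ ω₂ lam β γ : ℝ, 0 < ω₂ → 0 < lam → 0 < β → 0 < γ →
      (∀ (N : ℕ) (T_L T_R : ℝ), 0 < T_L → 0 < T_R → ∀ μ ν : Measure (PhaseSpace N),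
        (pinnedChain ω₂ lam β γ).IsSteadyState N T_L T_R μ →
        (pinnedChain ω₂ lam β γ).IsSteadyState N T_L T_R ν → μ = ν) →
      ∀ T : ℝ, 0 < T → ∃ C c : ℝ, 0 < c ∧ ∀ (N : ℕ) (hN : 2 ≤ N),
        let P := pinnedChain ω₂ lam β γ
        let μT := P.gibbsMeasure N T
        (∀ t : ℝ≥0, μT.bind (P.transitionKernel N T T t) = μT) →
        (∀ ϑ : ℝ, 0 < ϑ → ϑ < 1 / T → ∃ C c : ℝ, 0 < C ∧ 0 < c ∧
          ∀ (z : PhaseSpace N) (t : ℝ≥0) (f : PhaseSpace N → ℝ), Continuous f →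
            (∀ y, |f y| ≤ Real.exp (ϑ * P.hamiltonian N y)) →
            |(∫ y, f y ∂(P.transitionKernel N T T t z)) - ∫ y, f y ∂μT| ≤
              C * Real.exp (ϑ * P.hamiltonian N z) * Real.exp (-c * t)) →
        let g : PhaseSpace N → ℝ := fun y =>
          γ / (2 * T ^ 2) * (y.2 ⟨0, by omega⟩ ^ 2 - y.2 ⟨N - 1, by omega⟩ ^ 2)
        let Pg : ℝ → PhaseSpace N → ℝ := fun s z => ∫ y, g y ∂(P.transitionKernel N T T s.toNNReal z)
        let w : PhaseSpace N → ℝ := fun z => ∫ s in Set.Ioi (0 : ℝ), Pg s z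
        let Pw : ℝ → PhaseSpace N → ℝ := fun τ z => ∫ x, w x ∂(P.transitionKernel N T T τ.toNNReal z)
        ∃ τ : ℝ, 0 ≤ τ ∧ τ ≤ c * N ∧ MemLp (Pw τ) 2 μT ∧
          ∫ z, (Pw τ z - Pw τ (z.1, -z.2)) ^ 2 ∂μT ≤ C * N := by
  intro ω₂ lam β γ hω hl hβ hγ hU T hT
  obtain ⟨C', hC'⟩ := oddCorrectorBound_of_kuboCorrectorOddCubic hK ω₂ lam β γ hω hl hβ hγ hU T hT
  refine ⟨max C' 0, 1, one_pos, fun N hN => ?_⟩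
  intro P μT hInv hMix g Pg w Pw
  -- `w ∈ L²(μ_T)` from the landed S2a
  obtain ⟨-, hw2, -⟩ := stub_correctorIntegrability ω₂ lam β γ hω hl hβ hγ T hT N hN hInv hMix
  have hON : ∫ z, (w z - w (z.1, -z.2)) ^ 2 ∂μT ≤ C' * N := hC' N hN
  -- `P_0 w = w`
  have hP0 : ∀ z, Pw 0 z = w z := by
    intro z
    show ∫ x, w x ∂(P.transitionKernel N T T (Real.toNNReal 0) z) = w z
    rw [Real.toNNReal_zero, pinnedChain_transitionKernel_zero hω hl.le hβ.le hγ.le N T T,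
      ProbabilityTheory.Kernel.id_apply, integral_dirac]
  have hPw0 : Pw 0 = w := funext hP0
  have hN0 : (0 : ℝ) ≤ N := by positivity
  refine ⟨0, le_rfl, by positivity, ?_, ?_⟩
  · rw [hPw0]; exact hw2
  · rw [hPw0]
    calc ∫ z, (w z - w (z.1, -z.2)) ^ 2 ∂μT ≤ C' * N := hON
      _ ≤ max C' 0 * N := mul_le_mul_of_nonneg_right (le_max_left C' 0) hN0

/-- **The SPLIT theorem** — (K) `ExtensiveSnapshotIrreversibility` from its two sub-cruxes (S1r' fixed-`N` regularity, S4k `N`-uniform cubic odd bound), all other pieces landed. -/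
theorem ExtensiveSnapshotIrreversibility_of_subs
    (hR : ∀ ω₂ lam β γ : ℝ, 0 < ω₂ → 0 < lam → 0 < β → 0 < γ →
            (∀ (N : ℕ) (T_L T_R : ℝ), 0 < T_L → 0 < T_R → ∀ μ ν : Measure (PhaseSpace N),
              (pinnedChain ω₂ lam β γ).IsSteadyState N T_L T_R μ →
              (pinnedChain ω₂ lam β γ).IsSteadyState N T_L T_R ν → μ = ν) →
            ∀ μ : (N : ℕ) → ℝ → ℝ → Measure (PhaseSpace N),
              (∀ (N : ℕ) (T_L T_R : ℝ), 0 < T_L → 0 < T_R →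
                (pinnedChain ω₂ lam β γ).IsSteadyState N T_L T_R (μ N T_L T_R)) →
              ∀ T : ℝ, 0 < T → ∀ N : ℕ, 2 ≤ N →
                ∃ δ₀ η C : ℝ, ∃ k : ℕ, 0 < δ₀ ∧ 0 < η ∧ η < 1 / (4 * T) ∧
                ∃ φ : ℝ → PhaseSpace N → ℝ, ∃ d₀ : PhaseSpace N → ℝ,
                  (∀ δ : ℝ, Measurable (φ δ)) ∧ Measurable d₀ ∧
                  (∀ δ : ℝ, δ ≠ 0 → |δ| < δ₀ →
                    μ N (T + δ / 2) (T - δ / 2) =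
                      ((pinnedChain ω₂ lam β γ).gibbsMeasure N T).withDensity
                        (fun x => ENNReal.ofReal (Real.exp (φ δ x)))) ∧
                  (∀ δ : ℝ, |δ| < δ₀ → ∀ x : PhaseSpace N,
                    φ δ x ≤ η * (1 + (pinnedChain ω₂ lam β γ).hamiltonian N x)) ∧
                  (∀ x : PhaseSpace N, Tendsto (fun δ : ℝ => φ δ x) (𝓝[≠] (0 : ℝ)) (𝓝 0)) ∧
                  (∀ δ : ℝ, |δ| < δ₀ → ∀ x : PhaseSpace N,
                    |φ δ x - φ δ (x.1, -x.2)| ≤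
                      C * |δ| * (1 + (pinnedChain ω₂ lam β γ).hamiltonian N x) ^ k) ∧
                  (∀ x : PhaseSpace N,
                    Tendsto (fun δ : ℝ => (φ δ x - φ δ (x.1, -x.2)) / δ) (𝓝[≠] (0 : ℝ)) (𝓝 (d₀ x))))
    (hK : ∀ ω₂ lam β γ : ℝ, 0 < ω₂ → 0 < lam → 0 < β → 0 < γ → ∀ T : ℝ, 0 < T → ∃ C : ℝ,
            ∀ (N : ℕ) (u : PhaseSpace N → ℝ), 2 ≤ N →
              let P := pinnedChain ω₂ lam β γ
              let μT := P.gibbsMeasure N T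
              let J : PhaseSpace N → ℝ := fun z => ∑ i : Fin N, P.bondCurrent N i z
              MemLp u 2 μT →
              (∀ᵐ x ∂μT, Tendsto (fun τ : ℝ => ∫ t in Set.Ioc (0 : ℝ) τ,
                  (∫ y, J y ∂(P.transitionKernel N T T t.toNNReal x))) atTop (𝓝 (u x))) →
              ∫ x, (u x - u (x.1, -x.2)) ^ 2 ∂μT ≤ C * (N : ℝ) ^ 3) :
    ExtensiveSnapshotIrreversibility := by
  intro ω₂ lam β γ hω hl hβ hγ hU μ hμ T hT
  obtain ⟨C, c, hc, hLate⟩ := lateOddResponse_of_kuboCorrectorOddCubic hK ω₂ lam β γ hω hl hβ hγ hU T hT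
  -- bookkeeping functions (the line's objects at `N`, as real numbers)
  let g : (N : ℕ) → 2 ≤ N → PhaseSpace N → ℝ := fun N hN y =>
    γ / (2 * T ^ 2) * (y.2 ⟨0, by omega⟩ ^ 2 - y.2 ⟨N - 1, by omega⟩ ^ 2)
  let Pg : (N : ℕ) → 2 ≤ N → ℝ → PhaseSpace N → ℝ := fun N hN s z =>
    ∫ y, g N hN y ∂((pinnedChain ω₂ lam β γ).transitionKernel N T T s.toNNReal z)
  let k : (N : ℕ) → 2 ≤ N → ℝ → PhaseSpace N → ℝ := fun N hN τ z => ∫ s in (0 : ℝ)..τ, Pg N hN s z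
  let w : (N : ℕ) → 2 ≤ N → PhaseSpace N → ℝ := fun N hN z => ∫ s in Set.Ioi (0 : ℝ), Pg N hN s z
  let Pw : (N : ℕ) → 2 ≤ N → ℝ → PhaseSpace N → ℝ := fun N hN τ z =>
    ∫ x, w N hN x ∂((pinnedChain ω₂ lam β γ).transitionKernel N T T τ.toNNReal z)
  let μT : (N : ℕ) → Measure (PhaseSpace N) := fun N => (pinnedChain ω₂ lam β γ).gibbsMeasure N T
  let Dw : ℕ → ℝ := fun N =>
    if hN : 2 ≤ N then ∫ z, (w N hN z - w N hN (z.1, -z.2)) ^ 2 ∂(μT N) else 0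
  let Wk : ℕ → ℝ → ℝ := fun N τ => if hN : 2 ≤ N then ∫ z, (k N hN τ z) ^ 2 ∂(μT N) else 0
  let Dl : ℕ → ℝ → ℝ := fun N τ =>
    if hN : 2 ≤ N then ∫ z, (Pw N hN τ z - Pw N hN τ (z.1, -z.2)) ^ 2 ∂(μT N) else 0
  have hDw : ∀ N, 0 ≤ Dw N := fun N => by
    simp only [Dw]; split_ifs
    · exact integral_nonneg fun _ => sq_nonneg _
    · exact le_rfl
  have hWk : ∀ N τ, 0 ≤ Wk N τ := fun N τ => by
    simp only [Wk]; split_ifs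
    · exact integral_nonneg fun _ => sq_nonneg _
    · exact le_rfl
  have hDl : ∀ N τ, 0 ≤ Dl N τ := fun N τ => by
    simp only [Dl]; split_ifs
    · exact integral_nonneg fun _ => sq_nonneg _
    · exact le_rfl
  -- per-`N` facts from the stubs
  have facts : ∀ N : ℕ, ∀ hN : 2 ≤ N,
      (∀ ε : ℝ, 0 < ε → ∀ᶠ δ in 𝓝[≠] (0 : ℝ),
        klDiv (μ N (T + δ / 2) (T - δ / 2))
            (Measure.map (fun x : PhaseSpace N => (x.1, -x.2)) (μ N (T + δ / 2) (T - δ / 2)))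
          ≤ ENNReal.ofReal ((Dw N / 2 + ε) * δ ^ 2)) ∧
      (∀ τ : ℝ, 0 ≤ τ → Real.sqrt (Dw N) ≤ 2 * Real.sqrt (Wk N τ) + Real.sqrt (Dl N τ)) ∧
      (∀ τ : ℝ, 0 ≤ τ → Wk N τ ≤ γ * τ / (4 * T ^ 2)) ∧
      (∃ τ : ℝ, 0 ≤ τ ∧ τ ≤ c * N ∧ Dl N τ ≤ C * N) := by
    intro N hN
    have hN0 : 0 < N := by omega
    obtain ⟨hInv, hMix⟩ := stub_equilibriumKernelFacts ω₂ lam β γ hω hl hβ hγ hU T hT N hN0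
    obtain ⟨-, hw2, hwin⟩ := stub_correctorIntegrability ω₂ lam β γ hω hl hβ hγ T hT N hN hInv hMix
    have hCalc := stub_gibbsContactCalculus ω₂ lam β γ hω hl hβ hγ T hT N hN0
    have hId := stub_mcLennanIdentification ω₂ lam β γ hω hl hβ hγ hU μ hμ T hT N hN hInv hMix hw2
    obtain ⟨h, hRD⟩ := stub_responseDensity ω₂ lam β γ hω hl hβ hγ hU μ hμ T hT N
    have hKLh := stub_snapshotKLUpper_of_density (stub_oddLogDensity_of_oddRegularity hR)
      ω₂ lam β γ hω hl hβ hγ hU μ hμ T hT N hN h hRD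
    have hKL : ∀ ε : ℝ, 0 < ε → ∀ᶠ δ in 𝓝[≠] (0 : ℝ),
        klDiv (μ N (T + δ / 2) (T - δ / 2))
            (Measure.map (fun x : PhaseSpace N => (x.1, -x.2)) (μ N (T + δ / 2) (T - δ / 2)))
          ≤ ENNReal.ofReal (((∫ z, (w N hN z - w N hN (z.1, -z.2)) ^ 2 ∂(μT N)) / 2 + ε) * δ ^ 2) := by
      intro ε hε
      have hEq : ∫ x, (h x - h (x.1, -x.2)) ^ 2 ∂(μ N T T) =
          ∫ z, (w N hN z - w N hN (z.1, -z.2)) ^ 2 ∂(μT N) := hId h hRD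
      refine hKLh _ ?_
      rw [hEq]
      linarith
    have hBud := stub_clausiusBudget ω₂ lam β γ hω hl hβ hγ hU T hT N hN hInv hMix hCalc
      (fun τ hτ => (hwin τ hτ).1)
    obtain ⟨τ₀, hτ₀, hτ₀c, hPw2, hL⟩ := hLate N hN hInv hMix
    refine ⟨?_, ?_, ?_, ?_⟩
    · intro ε hε
      simpa only [Dw, dif_pos hN] using hKL ε hε
    · intro τ hτ
      obtain ⟨hk2, hPw2', hident⟩ := hwin τ hτ
      have h := stub_correctorCocycle ω₂ lam β γ hω hl hβ hγ T hT N (w N hN) (k N hN τ) (Pw N hN τ)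
        hw2 hk2 hPw2' hident
      simpa only [Dw, Wk, Dl, dif_pos hN] using h
    · intro τ hτ
      simpa only [Wk, dif_pos hN] using hBud τ hτ
    · exact ⟨τ₀, hτ₀, hτ₀c, by simpa only [Dl, dif_pos hN] using hL⟩
  exact concl_of_parts hω hl hβ hγ hU hμ hT hc Dw Wk Dl hDw hWk hDl
    (fun N hN => (facts N hN).1) (fun N hN => (facts N hN).2.1) (fun N hN => (facts N hN).2.2.1)
    (fun N hN => (facts N hN).2.2.2)

end Summit.AtomisticToContinuum.FouriersLaw.Theorems.ExtensiveSnapshotIrreversibility.Split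

end
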